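import Summits.QuantumFields.YangMills.Theorems.ColdStartUniversalityLatticeLangevinMeasurableFlow
import HarnessLib

/-!
# Route `ColdStartUniversality` (rung input (M), crux K_A1 stmt-QuantumFields-24809): the DECODING MAP of the regular
# solution flow — measurability (progressive form) and continuity on the modulus certificate (deterministic part)

Helper file (seat `ym-line-csu-p1`, g4), deterministic half of the «regular flow» construction used by the splicing
proof of the flow (cocycle) property (hypothesis of `chapmanKolmogorov_of_cocycle`).  Given net solutions `V k` and
measurable selectors `ι N`, the regular flow is `U x r ω = lim_n Ũ x (sampleLeft n r) ω`, `Ũ x d ω = lim_N V (ι N x) d ω`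
(left dyadic sampling `Literature.sampleLeft n r = (⌈2ⁿr⌉-1)/2ⁿ`, both limits Mathlib's total `limUnder`).  Here:

* `measurable_decode` — `(r, x, ω) ↦ U x r ω` on `[0, i] × SU(2)^E × Ω` is measurable as soon as the `V k d`, `d ≤ i`,
  are measurable for the σ-algebra put on `Ω` (apply with `𝓕_i`: progressive measurability, jointly in the start);
* `continuous_decode` — if `d ↦ Ũ x d ω` is, entrywise in the ambient `ℂ^{E×2×2}`, locally uniformly continuous on the
  dyadics (a countable, hence measurable, condition), the sampled limits exist and `r ↦ U x r ω` is continuous;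
* entry embedding `SU(2)^E ↪ ℂ^{E×2×2}` and `sampleLeft` bookkeeping.

The probabilistic half (`exists_regularFlow`) is `…LatticeLangevinRegularFlow`.  No definition, no sorry.
RECORD-rung R3 plumbing; nothing here bears on the mass gap.
-/

set_option autoImplicit false

noncomputable section

namespace Summit.QuantumFields.YangMills.Theorems.ColdStartUniversality

open MeasureTheory ProbabilityTheory Filter Topology
open scoped NNReal ENNReal BigOperators
open Literature Literature.Probability.Process Literature.MathematicalPhysics.QuantumFieldTheory
open Literature.MathematicalPhysics.QuantumLattice (fundamentalRep fundamentalLatticeRep continuous_fundamentalRep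
  fundamentalRep_injective)

/-! ## The entry embedding `SU(2)^E ↪ ℂ^{E × 2 × 2}` -/

section Entries

variable {L : ℕ}

/-- The entry map `x ↦ (e, i, j) ↦ (x e)ᵢⱼ` is continuous. [folklore] -/
theorem continuous_entries :
    Continuous fun x : GaugeConfig 3 L (Matrix.specialUnitaryGroup (Fin 2) ℂ) =>
      fun e (i j : Fin 2) => (x e : Matrix (Fin 2) (Fin 2) ℂ) i j :=
  continuous_pi fun e => continuous_pi fun i => continuous_pi fun j =>
    (continuous_subtype_val.comp (continuous_apply e)).matrix_elem i j

/-- Convergence in `SU(2)^E` is entrywise convergence. [folklore] -/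
theorem tendsto_iff_tendsto_entries {α : Type*} {l : Filter α}
    {y : α → GaugeConfig 3 L (Matrix.specialUnitaryGroup (Fin 2) ℂ)}
    {z : GaugeConfig 3 L (Matrix.specialUnitaryGroup (Fin 2) ℂ)} :
    Tendsto y l (𝓝 z) ↔
      Tendsto (fun a => fun e (i j : Fin 2) => (y a e : Matrix (Fin 2) (Fin 2) ℂ) i j) l
        (𝓝 (fun e (i j : Fin 2) => (z e : Matrix (Fin 2) (Fin 2) ℂ) i j)) := by
  refine ⟨fun h => (continuous_entries.tendsto z).comp h, fun h => ?_⟩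
  refine tendsto_pi_nhds.2 fun e => ?_
  rw [tendsto_subtype_rng]
  refine tendsto_pi_nhds.2 fun i => tendsto_pi_nhds.2 fun j => ?_
  have h1 := (continuous_apply j).tendsto _ |>.comp
    (((continuous_apply i).tendsto _).comp (((continuous_apply e).tendsto _).comp h))
  exact h1

end Entries

/-! ## The decoding map: measurability and continuity on the certificate -/

section Decode

variable {Ω : Type*} [MeasurableSpace Ω] {L : ℕ} [NeZero L]

/-- `sampleLeft n r ≤ r` for every `r` (also `r = 0`). [folklore] -/
theorem sampleLeft_le' (n : ℕ) (r : ℝ≥0) : sampleLeft n r ≤ r := by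
  by_cases h : r = 0
  · subst h
    simp [sampleLeft]
  · exact sampleLeft_le (pos_iff_ne_zero.2 h)

/-- `sampleLeft n r → r`. [folklore] -/
theorem tendsto_sampleLeft (r : ℝ≥0) : Tendsto (fun n => sampleLeft n r) atTop (𝓝 r) := by
  by_cases h : r = 0
  · subst h
    have h0 : (fun n => sampleLeft n 0) = fun _ => 0 := funext fun n => by simp [sampleLeft]
    rw [h0]
    exact tendsto_const_nhds
  · have hr : 0 < r := pos_iff_ne_zero.2 h
    rw [← NNReal.tendsto_coe]
    have hup : ∀ n, (sampleLeft n r : ℝ) ≤ r := fun n => NNReal.coe_le_coe.2 (sampleLeft_le hr)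
    have hlow : ∀ n, (r : ℝ) - 1 / 2 ^ n ≤ sampleLeft n r := fun n => by
      linarith [(sampleLeft_le_and_sub_le (n := n) hr).2]
    have hlim : Tendsto (fun n : ℕ => (r : ℝ) - 1 / 2 ^ n) atTop (𝓝 r) := by
      have h0 : Tendsto (fun n : ℕ => (1 : ℝ) / 2 ^ n) atTop (𝓝 0) := by
        simp_rw [one_div, ← inv_pow]
        exact tendsto_pow_atTop_nhds_zero_of_lt_one (by norm_num) (by norm_num)
      simpa using (tendsto_const_nhds (x := (r : ℝ))).sub h0
    exact tendsto_of_tendsto_of_tendsto_of_le_of_le hlim tendsto_const_nhds hlow hup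

/-- `sampleLeft n r = (⌈2ⁿ r⌉ - 1) / 2ⁿ` depends on `r` only through the natural number `⌈2ⁿ r⌉ - 1`. [folklore] -/
theorem sampleLeft_eq_div (n : ℕ) (r : ℝ≥0) :
    sampleLeft n r = ((⌈(r : ℝ) * 2 ^ n⌉₊ - 1 : ℕ) : ℝ≥0) / 2 ^ n := rfl

/-- The index `r ↦ ⌈2ⁿ r⌉ - 1` is measurable. [folklore] -/
theorem measurable_sampleIndex (n : ℕ) : Measurable fun r : ℝ≥0 => (⌈(r : ℝ) * 2 ^ n⌉₊ - 1 : ℕ) :=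
  (Nat.measurable_ceil.comp (measurable_coe_nnreal_real.mul_const _)).sub_const 1

/-- **Measurability of the decoding map (progressive form).**  For net solutions `V k` whose values at times `≤ i`
are measurable (for the σ-algebra put on `Ω`) and measurable selectors `ι N`, the two-level limit
`(r, x, ω) ↦ lim_n lim_N V (ι N x) ((sampleLeft n r) ∧ i) ω` is jointly measurable on `[0, i] × SU(2)^E × Ω`.
(Countably many measurable observables, total limits `limUnder`.) [folklore] -/
theorem measurable_decode (V : ℕ → ℝ≥0 → Ω → GaugeConfig 3 L (Matrix.specialUnitaryGroup (Fin 2) ℂ))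
    (ι : ℕ → GaugeConfig 3 L (Matrix.specialUnitaryGroup (Fin 2) ℂ) → ℕ) (hι : ∀ n, Measurable (ι n)) (i : ℝ≥0)
    (hV : ∀ (k : ℕ) (d : ℝ≥0), d ≤ i → Measurable (V k d)) :
    Measurable fun q : Set.Iic i × (GaugeConfig 3 L (Matrix.specialUnitaryGroup (Fin 2) ℂ) × Ω) =>
      limUnder atTop (fun n => limUnder atTop (fun N => V (ι N q.2.1) (min (sampleLeft n q.1) i) q.2.2)) := by
  classical
  haveI := secondCountableTopology_su2
  haveI := borelSpace_config L
  haveI := polishSpace_config L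
  haveI : Nonempty (GaugeConfig 3 L (Matrix.specialUnitaryGroup (Fin 2) ℂ)) := ⟨fun _ => 1⟩
  -- inner limit at a fixed time `d ≤ i`, jointly in `(x, ω)`
  have hinner : ∀ d : ℝ≥0, d ≤ i → Measurable fun q : GaugeConfig 3 L (Matrix.specialUnitaryGroup (Fin 2) ℂ) × Ω =>
      limUnder atTop (fun N => V (ι N q.1) d q.2) := by
    intro d hd
    have hf : ∀ N, Measurable fun q : GaugeConfig 3 L (Matrix.specialUnitaryGroup (Fin 2) ℂ) × Ω =>
        V (ι N q.1) d q.2 := fun N => by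
      have h1 : Measurable fun p : Ω × ℕ => V p.2 d p.1 :=
        measurable_from_prod_countable_left fun k => hV k d hd
      have h2 := h1.comp (measurable_snd.prodMk ((hι N).comp measurable_fst))
      exact h2
    exact (MeasureTheory.StronglyMeasurable.limUnder (l := atTop) fun N => (hf N).stronglyMeasurable).measurable
  -- level `n`: through the countable index `⌈2ⁿ r⌉ - 1`
  have hlevel : ∀ n, Measurable fun q : Set.Iic i × (GaugeConfig 3 L (Matrix.specialUnitaryGroup (Fin 2) ℂ) × Ω) =>
      limUnder atTop (fun N => V (ι N q.2.1) (min (sampleLeft n q.1) i) q.2.2) := by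
    intro n
    have hg : Measurable fun p : ℕ × (GaugeConfig 3 L (Matrix.specialUnitaryGroup (Fin 2) ℂ) × Ω) =>
        limUnder atTop (fun N => V (ι N p.2.1) (min (((p.1 : ℕ) : ℝ≥0) / 2 ^ n) i) p.2.2) :=
      measurable_from_prod_countable_right fun k => hinner (min (((k : ℕ) : ℝ≥0) / 2 ^ n) i) (min_le_right _ _)
    have hk : Measurable fun q : Set.Iic i × (GaugeConfig 3 L (Matrix.specialUnitaryGroup (Fin 2) ℂ) × Ω) =>
        ((⌈((q.1 : ℝ≥0) : ℝ) * 2 ^ n⌉₊ - 1 : ℕ), q.2) :=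
      ((measurable_sampleIndex n).comp (measurable_subtype_coe.comp measurable_fst)).prodMk measurable_snd
    have h := hg.comp hk
    exact h
  exact (MeasureTheory.StronglyMeasurable.limUnder (l := atTop) fun n => (hlevel n).stronglyMeasurable).measurable

/-- The left dyadic sample point is within `2⁻ⁿ` of the time. [folklore] -/
theorem dist_sampleLeft_le (n : ℕ) (r : ℝ≥0) : dist (sampleLeft n r) r ≤ 1 / 2 ^ n := by
  rw [NNReal.dist_eq]
  by_cases h : r = 0
  · subst h
    simp [sampleLeft]
  · have hr : 0 < r := pos_iff_ne_zero.2 h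
    have h1 : (sampleLeft n r : ℝ) ≤ r := NNReal.coe_le_coe.2 (sampleLeft_le hr)
    have h2 := (sampleLeft_le_and_sub_le (n := n) hr).2
    rw [abs_sub_comm, abs_of_nonneg (sub_nonneg.2 h1)]
    exact h2

/-- Two left dyadic sample points of nearby times are nearby. [folklore] -/
theorem dist_sampleLeft_sampleLeft_le (n n' : ℕ) (r r' : ℝ≥0) :
    dist (sampleLeft n r) (sampleLeft n' r') ≤ 1 / 2 ^ n + dist r r' + 1 / 2 ^ n' :=
  calc dist (sampleLeft n r) (sampleLeft n' r')
      ≤ dist (sampleLeft n r) r + dist r r' + dist r' (sampleLeft n' r') := dist_triangle4 _ _ _ _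
    _ ≤ 1 / 2 ^ n + dist r r' + 1 / 2 ^ n' := by
        have h1 := dist_sampleLeft_le n r
        have h2 := dist_sampleLeft_le n' r'
        rw [dist_comm] at h2
        linarith

omit [NeZero L] in
/-- **Continuity of the decoded path on the certificate.**  If `g` is, entrywise, locally uniformly continuous on the
dyadic times (for every horizon `m` and precision `(j+1)⁻¹` a mesh `(k+1)⁻¹`), then the left-sampled limit path
`r ↦ lim_n g (sampleLeft n r)` converges at every time and is continuous. [folklore] -/
theorem continuous_decode [NeZero L] {g : ℝ≥0 → GaugeConfig 3 L (Matrix.specialUnitaryGroup (Fin 2) ℂ)}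
    (hG : ∀ m j : ℕ, ∃ k : ℕ, ∀ a b : ℕ × ℕ,
      ((a.2 : ℝ≥0) / 2 ^ a.1) ≤ m → ((b.2 : ℝ≥0) / 2 ^ b.1) ≤ m →
      dist ((a.2 : ℝ≥0) / 2 ^ a.1) ((b.2 : ℝ≥0) / 2 ^ b.1) ≤ ((k : ℝ) + 1)⁻¹ →
      dist (fun e (i j : Fin 2) => (g ((a.2 : ℝ≥0) / 2 ^ a.1) e : Matrix (Fin 2) (Fin 2) ℂ) i j)
        (fun e (i j : Fin 2) => (g ((b.2 : ℝ≥0) / 2 ^ b.1) e : Matrix (Fin 2) (Fin 2) ℂ) i j) ≤ ((j : ℝ) + 1)⁻¹) :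
    (∀ r, ∃ z, Tendsto (fun n => g (sampleLeft n r)) atTop (𝓝 z)) ∧
      Continuous fun r => limUnder atTop (fun n => g (sampleLeft n r)) := by
  set E : GaugeConfig 3 L (Matrix.specialUnitaryGroup (Fin 2) ℂ) → (Edge 3 L → Fin 2 → Fin 2 → ℂ) :=
    fun x e i j => (x e : Matrix (Fin 2) (Fin 2) ℂ) i j with hE
  have hEc : Continuous E := continuous_entries
  -- the modulus applied to two sample points below a horizon
  have hmod : ∀ (m j : ℕ), ∃ k : ℕ, ∀ (n n' : ℕ) (r r' : ℝ≥0), r ≤ m → r' ≤ m →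
      dist (sampleLeft n r) (sampleLeft n' r') ≤ ((k : ℝ) + 1)⁻¹ →
      dist (E (g (sampleLeft n r))) (E (g (sampleLeft n' r'))) ≤ ((j : ℝ) + 1)⁻¹ := by
    intro m j
    obtain ⟨k, hk⟩ := hG m j
    refine ⟨k, fun n n' r r' hr hr' hd => ?_⟩
    exact hk (n, ⌈(r : ℝ) * 2 ^ n⌉₊ - 1) (n', ⌈(r' : ℝ) * 2 ^ n'⌉₊ - 1)
      ((sampleLeft_le' n r).trans hr) ((sampleLeft_le' n' r').trans hr') hd
  -- small dyadic meshes
  have hmesh : ∀ c : ℝ, 0 < c → ∃ N : ℕ, ∀ n, N ≤ n → (1 : ℝ) / 2 ^ n ≤ c := by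
    intro c hc
    obtain ⟨N, hN⟩ := exists_pow_lt_of_lt_one hc (by norm_num : (1 / 2 : ℝ) < 1)
    refine ⟨N, fun n hn => ?_⟩
    have h1 : (1 : ℝ) / 2 ^ n ≤ 1 / 2 ^ N :=
      one_div_le_one_div_of_le (by positivity) (pow_le_pow_right₀ (by norm_num) hn)
    rw [one_div_pow] at hN
    exact h1.trans hN.le
  -- Step 1: convergence at every time
  have hconv : ∀ r, ∃ z, Tendsto (fun n => g (sampleLeft n r)) atTop (𝓝 z) := by
    intro r
    have hC : CauchySeq (fun n => E (g (sampleLeft n r))) := by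
      rw [Metric.cauchySeq_iff]
      intro ε hε
      obtain ⟨j, hj⟩ := exists_nat_one_div_lt hε
      obtain ⟨k, hk⟩ := hmod ⌈(r : ℝ)⌉₊ j
      obtain ⟨N, hN⟩ := hmesh (((k : ℝ) + 1)⁻¹ / 2) (by positivity)
      refine ⟨N, fun n hn n' hn' => ?_⟩
      have hrm : r ≤ (⌈(r : ℝ)⌉₊ : ℕ) := by
        rw [← NNReal.coe_le_coe, NNReal.coe_natCast]
        exact Nat.le_ceil _
      have hd : dist (sampleLeft n r) (sampleLeft n' r) ≤ ((k : ℝ) + 1)⁻¹ := by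
        have h := dist_sampleLeft_sampleLeft_le n n' r r
        rw [dist_self, add_zero] at h
        linarith [hN n hn, hN n' hn']
      have h := hk n n' r r hrm hrm hd
      rw [one_div] at hj
      exact lt_of_le_of_lt h hj
    obtain ⟨c, hc⟩ := cauchySeq_tendsto_of_complete hC
    have hcl : IsClosed (Set.range E) := (isCompact_range hEc).isClosed
    have hmem : c ∈ Set.range E := hcl.mem_of_tendsto hc (Eventually.of_forall fun n => ⟨_, rfl⟩)
    obtain ⟨z, hz⟩ := hmem
    refine ⟨z, tendsto_iff_tendsto_entries.2 ?_⟩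
    have hc' : Tendsto (fun n => E (g (sampleLeft n r))) atTop (𝓝 (E z)) := by rwa [hz]
    exact hc'
  refine ⟨hconv, ?_⟩
  choose z hz using hconv
  have hf : (fun r => limUnder atTop fun n => g (sampleLeft n r)) = z := funext fun r => (hz r).limUnder_eq
  rw [hf]
  have hEz : ∀ r, Tendsto (fun n => E (g (sampleLeft n r))) atTop (𝓝 (E (z r))) := fun r =>
    (hEc.tendsto _).comp (hz r)
  -- Step 2: continuity, entrywise
  have hcontE : Continuous fun r => E (z r) := by
    rw [Metric.continuous_iff]
    intro r₀ ε hε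
    obtain ⟨j, hj⟩ := exists_nat_one_div_lt (half_pos hε)
    obtain ⟨k, hk⟩ := hmod (⌈(r₀ : ℝ)⌉₊ + 1) j
    refine ⟨min 1 (((k : ℝ) + 1)⁻¹ / 2), by positivity, fun r hr => ?_⟩
    have hr1 : dist r r₀ < 1 := lt_of_lt_of_le hr (min_le_left _ _)
    have hr2 : dist r r₀ < ((k : ℝ) + 1)⁻¹ / 2 := lt_of_lt_of_le hr (min_le_right _ _)
    have hr₀m : r₀ ≤ ((⌈(r₀ : ℝ)⌉₊ + 1 : ℕ) : ℝ≥0) := by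
      rw [← NNReal.coe_le_coe, NNReal.coe_natCast]
      push_cast
      linarith [Nat.le_ceil (r₀ : ℝ)]
    have hrm : r ≤ ((⌈(r₀ : ℝ)⌉₊ + 1 : ℕ) : ℝ≥0) := by
      rw [← NNReal.coe_le_coe, NNReal.coe_natCast]
      push_cast
      rw [NNReal.dist_eq] at hr1
      linarith [Nat.le_ceil (r₀ : ℝ), (abs_lt.1 hr1).2]
    obtain ⟨N, hN⟩ := hmesh (((k : ℝ) + 1)⁻¹ / 4) (by positivity)
    have hev : ∀ᶠ n in atTop, dist (E (g (sampleLeft n r))) (E (g (sampleLeft n r₀))) ≤ ((j : ℝ) + 1)⁻¹ := by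
      refine eventually_atTop.2 ⟨N, fun n hn => ?_⟩
      refine hk n n r r₀ hrm hr₀m ?_
      have h := dist_sampleLeft_sampleLeft_le n n r r₀
      linarith [hN n hn]
    have hlim : Tendsto (fun n => dist (E (g (sampleLeft n r))) (E (g (sampleLeft n r₀)))) atTop
        (𝓝 (dist (E (z r)) (E (z r₀)))) := (hEz r).dist (hEz r₀)
    have hle := le_of_tendsto hlim hev
    rw [one_div] at hj
    linarith
  rw [continuous_iff_continuousAt]
  intro r₀
  exact (tendsto_iff_tendsto_entries (l := 𝓝 r₀) (y := z) (z := z r₀)).2 (hcontE.tendsto r₀)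

end Decode

end Summit.QuantumFields.YangMills.Theorems.ColdStartUniversality

end
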